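import Summits.HodgeConjecture.HodgeConjecture.Theses.HodgeProjectorDivisorSupport
import Summits.HodgeConjecture.HodgeConjecture.Theorems.HodgeProjectorDivisorSupportHodgeProjectorDivisorSupportedRationalDescent
import Literature.AlgebraicGeometry.HodgeTheory.ClassesSupportedOnComplexification
import Literature.AlgebraicGeometry.HodgeTheory.CycleClassPrincipalDivisorOfProjectiveSpace
import Literature.AlgebraicGeometry.HodgeTheory.HardLefschetzThreefold
import Literature.AlgebraicGeometry.HodgeTheory.HodgeTypeConjugation
import Literature.AlgebraicGeometry.HodgeTheory.HodgeModelExistence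
import Literature.AlgebraicGeometry.HodgeTheory.ComplexConjugationHolds
import HarnessLib

/-!
# Crux `HodgeProjectorDivisorSupported` (stmt-HodgeConjecture-18704), line `birth` — stub D
# `stub_integralProjectorCycle`: ℚ-DESCENT OF A COMPLEX COMBINATION OF CYCLE CLASSES ACTING AS THE HODGE PROJECTOR

Route `HodgeConjecture/HodgeProjectorDivisorSupport`; registered skeleton
`Cruxes/HodgeProjectorDivisorSupported/Lines/birth.lean` (`HodgeProjectorDivisorSupported_of`: STUB K purity of the
coniveau filtration → STUB D (this file) → STUB H two-sided Bloch–Srinivas decomposition of the projector, open);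
STUB D is shared verbatim by the strategist's line `projector-qbar-descent` (card `Lines/projector-qbar-descent.md`).

**Theorem** (`stub_integralProjectorCycle`, the registered signature verbatim). `X` smooth projective of dimension
`2n`, `ρ` a resolution family of `X × X` in dimension `2n`, `π` a `ℂ`-linear combination of cycle classes
`[Zᵢ] = cycleClass complexOrientationFamily … ρ Zᵢ` of integral `2n`-cycles on `X × X` whose action
`corrAction complexOrientationFamily hX hX … π` on `H^{2n}(X(ℂ); ℂ)` is the identity on the rational `(n,n)`-classes
and zero on their cup-orthogonal. Then for one INTEGRAL `2n`-cycle `Z` and `u ≠ 0` (indeed `u ∈ ℕ`), `[Z]_*` is `u •`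
the identity on the rational `(n,n)`-classes and zero on their cup-orthogonal.

Proof. §1–§2 live in the helper file
`HodgeProjectorDivisorSupportHodgeProjectorDivisorSupportedRationalDescent.lean`: §1 is the linear algebra of
`ℚ`-structures `β : A ⊗_ℚ V₀ ≃ V` over a field `A ⊇ ℚ` (`exists_int_combination`): if `Φ = Σ cᵢ Tᵢ` (`cᵢ ∈ A`, `Tᵢ = β (ψᵢ ⊗ 1) β⁻¹` defined over `ℚ`) is the identity
on rational vectors `a ∈ S₀` and kills the common kernel of finitely many maps `L_k = β' (ℓ_k ⊗ 1) β⁻¹` defined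
over `ℚ`, then so does `Σ r(cᵢ) Tᵢ` for any `ℚ`-linear retraction `r : A → ℚ` of `ℚ ⊆ A` — on the `a ∈ S₀`
by applying `r ⊗ 1`, on the common kernel because it is the base change of `⋂ ker ℓ_k` (`A` is flat over `ℚ`:
`Module.Flat.ker_lTensor_eq`, `TensorProduct.piRight`) — and clearing denominators gives integers `mᵢ = N r(cᵢ)`
with `Σ mᵢ Tᵢ = N •` the identity on `S₀` and zero on the kernel. §2: a `ℂ`-linear map of complex cohomology
groups carrying rational classes to rational classes descends to the lattices (`exists_ratLinearMap_ofRatClass`).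
§3 feeds §1 with `V₀ = H^{2n}(X(ℂ); ℚ)`, `W₀ = H^{4n}(X(ℂ); ℚ)` (`ofRatClassBaseChangeEquiv`, Voisin I §7.1.1),
`S₀` = the lattice vectors whose image is of type `(n,n)` (a `ℚ`-subspace `H₀`, finite-dimensional by
`finiteDimensional_bettiCohomology`), `L_k` = cup product with a basis vector of `H₀` (rational:
`IsRationalClass.cup`; the cup-orthogonal of ALL rational `(n,n)`-classes is their common kernel by bilinearity),
`Tᵢ = [Zᵢ]_* = pr₁₊(pr₂^* (·) ∪ [Zᵢ])` (rational: `isRationalClass_cycleClass`, `IsRationalClass.pullback`,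
`IsRationalClass.cup`, `isRationalClass_complexGysin_complexOrientationFamily`), and `Z := Σ mᵢ Zᵢ` (additivity of
`cycleClass` and linearity of `corrAction`). §4: the crux BY NAME from the two remaining registered stubs K, H.

HONEST STATUS. A `ℚ`-descent lemma; nothing here is a case of the Hodge conjecture. STUB K (purity, Fulton §19.1;
known, L) and STUB H (the heart; open off the `CH₀`-small sector) remain. No definition, no named fact, no sorry.
References: [VoisinHodgeI2002] §7.1.1, §7.3.2, §11.1.4; [FultonYoungTableaux1997] App. B §B.1 (5);
[HatcherAT2002] §3.1 p. 198; [Fulton1998] §19.1; [BlochSrinivas1983] Prop. 1.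
-/

noncomputable section

set_option linter.dupNamespace false

open scoped TensorProduct
open CategoryTheory MonoidalCategory CartesianMonoidalCategory AlgebraicGeometry
open Literature.AlgebraicGeometry.Motives Literature.AlgebraicGeometry.HodgeTheory
open Literature.AlgebraicTopology.SingularHomology

namespace Summit.HodgeConjecture.HodgeConjecture.Theorems.HodgeProjectorDivisorSupported

/-! ## §3 The stub, in the registered spelling -/

section Stub

/-- **Stub `stub_integralProjectorCycle` of crux `HodgeProjectorDivisorSupported` (registered
signature, verbatim): ℚ-descent to an integral projector cycle.** For `X` smooth projective of
dimension `2n ≥ 2` and a resolution family `ρ` of `X × X` in dimension `2n`: if a `ℂ`-linear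
combination `π` of cycle classes of `2n`-cycles on `X × X` acts on `H^{2n}(X(ℂ); ℂ)` as the
orthogonal Hodge projector (identity on rational `(n,n)`-classes, zero on their cup-orthogonal),
then the class of one INTEGRAL `2n`-cycle `Z` acts as `u •` (that projector) for some `u ≠ 0`
(indeed `u ∈ ℕ`). Proof: §1 applied to the `ℚ`-structures `H^{2n}(X(ℂ); ℚ) ⊗ ℂ = H^{2n}(X(ℂ); ℂ)`,
`H^{4n}(X(ℂ); ℚ) ⊗ ℂ = H^{4n}(X(ℂ); ℂ)` (`ofRatClassBaseChangeEquiv`), the rational operators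
`[Zᵢ]_*` (`isRationalClass_cycleClass`, `IsRationalClass.cup`, `IsRationalClass.pullback`,
`isRationalClass_complexGysin_complexOrientationFamily`), the rational maps "cup with a basis vector
of the rational `(n,n)`-classes", and the set of rational `(n,n)`-classes.
[cite: VoisinHodgeI2002, §7.1.1 and §11.1.4] [cite: FultonYoungTableaux1997, App. B §B.1 (5)] -/
theorem stub_integralProjectorCycle :
    ∀ (n : ℕ) (X : SchemeOver ℂ) (hX : IsSmoothProjective (2 * n) X)
      (ρ : ResolutionFamily (X ⊗ X) (2 * n)), 1 ≤ n →
      ∀ π ∈ Submodule.span ℂ (Set.range (cycleClass complexOrientationFamily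
          (IsSmoothProjective.tensor_holds hX hX) (rfl : 2 * n + 2 * n = 2 * n + 2 * n) ρ)),
        (∀ c : complexBetti X (2 * n), IsRationalClass c → IsOfHodgeType (2 * n) X (2 * n) n n c →
          corrAction complexOrientationFamily hX hX
            (rfl : 2 * n + 2 * (2 * n) = 2 * n + 2 * (2 * n)) π c = c) →
        (∀ b : complexBetti X (2 * n),
          (∀ a : complexBetti X (2 * n), IsRationalClass a → IsOfHodgeType (2 * n) X (2 * n) n n a →
            cupProduct (rfl : 2 * n + 2 * n = 2 * n + 2 * n) a b = 0) →
          corrAction complexOrientationFamily hX hX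
            (rfl : 2 * n + 2 * (2 * n) = 2 * n + 2 * (2 * n)) π b = 0) →
        ∃ (Z : ↥(cyclesOfDim (X ⊗ X).left (2 * n))) (u : ℂ), u ≠ 0 ∧
          (∀ c : complexBetti X (2 * n), IsRationalClass c → IsOfHodgeType (2 * n) X (2 * n) n n c →
            corrAction complexOrientationFamily hX hX
              (rfl : 2 * n + 2 * (2 * n) = 2 * n + 2 * (2 * n))
              (cycleClass complexOrientationFamily (IsSmoothProjective.tensor_holds hX hX)
                (rfl : 2 * n + 2 * n = 2 * n + 2 * n) ρ Z) c = u • c) ∧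
          (∀ b : complexBetti X (2 * n),
            (∀ a : complexBetti X (2 * n), IsRationalClass a → IsOfHodgeType (2 * n) X (2 * n) n n a →
              cupProduct (rfl : 2 * n + 2 * n = 2 * n + 2 * n) a b = 0) →
            corrAction complexOrientationFamily hX hX
              (rfl : 2 * n + 2 * (2 * n) = 2 * n + 2 * (2 * n))
              (cycleClass complexOrientationFamily (IsSmoothProjective.tensor_holds hX hX)
                (rfl : 2 * n + 2 * n = 2 * n + 2 * n) ρ Z) b = 0) := by
  intro n X hX ρ _hn π hπ hid hzero
  classical
  set cl := cycleClass complexOrientationFamily (IsSmoothProjective.tensor_holds hX hX)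
    (rfl : 2 * n + 2 * n = 2 * n + 2 * n) ρ with hcl
  set act := corrAction complexOrientationFamily hX hX
    (rfl : 2 * n + 2 * (2 * n) = 2 * n + 2 * (2 * n)) with hact
  -- the two ℚ-structures `Hᵏ(X(ℂ); ℚ) ⊗ ℂ = Hᵏ(X(ℂ); ℂ)`, `k = 2n, 4n`
  set β := ofRatClassBaseChangeEquiv hX (2 * n) with hβdef
  set β' := ofRatClassBaseChangeEquiv hX (2 * n + 2 * n) with hβ'def
  have hβ : ∀ a, β ((1 : ℂ) ⊗ₜ a) = ofRatClass (ComplexPoints X) (2 * n) a := fun a ↦ by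
    rw [hβdef, ofRatClassBaseChangeEquiv_apply, ofRatClassBaseChange_tmul, one_smul]
  have hβ' : ∀ w, β' ((1 : ℂ) ⊗ₜ w) = ofRatClass (ComplexPoints X) (2 * n + 2 * n) w := fun w ↦ by
    rw [hβ'def, ofRatClassBaseChangeEquiv_apply, ofRatClassBaseChange_tmul, one_smul]
  -- the rational `(n,n)`-classes: the ℚ-subspace `H₀` of the lattice
  have h0 : IsOfHodgeType (2 * n) X (2 * n) n n (0 : complexBetti X (2 * n)) :=
    isOfHodgeType_zero_of_isSmoothProjective nonempty_hodgeModel_holds hX _ _ _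
  let H₀ : Submodule ℚ (bettiCohomology X (2 * n)) :=
    { carrier := {a | IsOfHodgeType (2 * n) X (2 * n) n n (ofRatClass (ComplexPoints X) (2 * n) a)}
      zero_mem' := by simp only [Set.mem_setOf_eq, map_zero]; exact h0
      add_mem' := fun {a b} ha hb ↦ by
        simp only [Set.mem_setOf_eq, map_add] at ha hb ⊢
        exact ha.add hX hb
      smul_mem' := fun q a ha ↦ by
        simp only [Set.mem_setOf_eq] at ha ⊢
        rw [ofRatClass_smul]
        exact ha.smul _ }
  have hHdg : ∀ c : complexBetti X (2 * n), IsRationalClass c → IsOfHodgeType (2 * n) X (2 * n) n n c →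
      ∃ a ∈ H₀, c = ofRatClass (ComplexPoints X) (2 * n) a := fun c hc hh ↦ by
    obtain ⟨a, rfl⟩ := (isRationalClass_iff_mem_range_ofRatClass c).1 hc
    exact ⟨a, hh, rfl⟩
  haveI : FiniteDimensional ℚ (bettiCohomology X (2 * n)) := finiteDimensional_bettiCohomology hX _
  let bH := Module.finBasis ℚ H₀
  -- the rational maps `L k := (e_k ⊗ 1) ∪ ·` for a basis `e_k` of `H₀`, and their descents `ℓ k`
  set L : Fin (Module.finrank ℚ H₀) →
      (complexBetti X (2 * n) →ₗ[ℂ] complexBetti X (2 * n + 2 * n)) :=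
    fun k ↦ cupProduct (rfl : 2 * n + 2 * n = 2 * n + 2 * n)
      (ofRatClass (ComplexPoints X) (2 * n) (bH k : bettiCohomology X (2 * n))) with hL
  have hLrat : ∀ k y, IsRationalClass y → IsRationalClass (L k y) := fun k y hy ↦
    (isRationalClass_ofRatClass _).cup _ hy
  choose ℓ hℓ using fun k ↦ exists_ratLinearMap_ofRatClass (L k) (hLrat k)
  -- the operators `T Z := [Z]_*` and their descents `ψ Z`
  set T : ↥(cyclesOfDim (X ⊗ X).left (2 * n)) →
      (complexBetti X (2 * n) →ₗ[ℂ] complexBetti X (2 * n)) := fun Z ↦ act (cl Z) with hT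
  have hTrat : ∀ Z y, IsRationalClass y → IsRationalClass (T Z y) := fun Z y hy ↦ by
    simp only [hT, hact, corrAction_apply]
    exact isRationalClass_complexGysin_complexOrientationFamily _ _ _ _
      ((hy.pullback _).cup _ (isRationalClass_cycleClass _ _ ρ Z))
  choose ψ hψ using fun Z ↦ exists_ratLinearMap_ofRatClass (T Z) (hTrat Z)
  -- the complex combination `π = Σ c i • [Z i]`
  obtain ⟨c, hc⟩ := Finsupp.mem_span_range_iff_exists_finsupp.1 hπ
  have hΦ : act π = ∑ i ∈ c.support, c i • T i := by
    rw [← hc, Finsupp.sum, map_sum]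
    exact Finset.sum_congr rfl fun i _ ↦ by rw [map_smul]
  -- the cup-orthogonal of the rational `(n,n)`-classes is the common kernel of the `L k`
  have hperp : ∀ b : complexBetti X (2 * n), (∀ k, L k b = 0) →
      ∀ a : complexBetti X (2 * n), IsRationalClass a → IsOfHodgeType (2 * n) X (2 * n) n n a →
        cupProduct (rfl : 2 * n + 2 * n = 2 * n + 2 * n) a b = 0 := by
    intro b hb a ha hh
    obtain ⟨a₀, ha₀, rfl⟩ := hHdg a ha hh
    have ha₀eq : a₀ = ∑ k, (bH.repr ⟨a₀, ha₀⟩ k) • (bH k : bettiCohomology X (2 * n)) := by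
      have h := congrArg Subtype.val (bH.sum_repr ⟨a₀, ha₀⟩)
      rw [Submodule.coe_sum] at h
      simp only [Submodule.coe_smul_of_tower] at h
      exact h.symm
    rw [ha₀eq, map_sum, map_sum, LinearMap.sum_apply]
    refine Finset.sum_eq_zero fun k _ ↦ ?_
    rw [ofRatClass_smul, map_smul, LinearMap.smul_apply, hb k, smul_zero]
  have hperp' : ∀ b : complexBetti X (2 * n),
      (∀ a : complexBetti X (2 * n), IsRationalClass a → IsOfHodgeType (2 * n) X (2 * n) n n a →
        cupProduct (rfl : 2 * n + 2 * n = 2 * n + 2 * n) a b = 0) → ∀ k, L k b = 0 :=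
    fun b hb k ↦ hb _ (isRationalClass_ofRatClass _) (bH k).2
  -- the descent lemma of §1
  obtain ⟨N, m, hN, h1, h2⟩ := exists_int_combination β β' L ℓ
    (fun k v ↦ by rw [hβ, hβ', hℓ]) (H₀ : Set (bettiCohomology X (2 * n))) c.support T ψ
    (fun i v ↦ by rw [hβ, hψ, hβ]) c
    (fun a ha ↦ by rw [hβ, ← hΦ]; exact hid _ (isRationalClass_ofRatClass _) ha)
    (fun b hb ↦ by rw [← hΦ]; exact hzero b (hperp b hb))
  -- the integral cycle `Z := Σ m i • Z i`, `u := N`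
  have hZ : act (cl (∑ i ∈ c.support, m i • i)) = ∑ i ∈ c.support, m i • T i := by
    rw [map_sum, map_sum]
    exact Finset.sum_congr rfl fun i _ ↦ by rw [map_zsmul, map_zsmul]
  refine ⟨∑ i ∈ c.support, m i • i, (N : ℂ), Nat.cast_ne_zero.2 hN, fun x hx hh ↦ ?_, fun b hb ↦ ?_⟩
  · obtain ⟨a, ha, rfl⟩ := hHdg x hx hh
    rw [hZ, ← hβ, h1 a ha, Nat.cast_smul_eq_nsmul]
  · rw [hZ]
    exact h2 b (hperp' b hb)

end Stub

/-! ## §4 The crux from the two remaining stubs (purity K, decomposition H) -/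

section Crux

/-- **The crux `HodgeProjectorDivisorSupported` BY NAME from STUB K (purity: algebraic classes are
spanned by cycle classes) and STUB H (two-sided homological Bloch–Srinivas decomposition of an
integral projector cycle)** — the skeleton's composition `HodgeProjectorDivisorSupported_of` with
STUB D = `stub_integralProjectorCycle` (this file) discharged; the two hypotheses are the registered
signatures of `stub_algebraicClasses_le_span_cycleClass` and `stub_crossDecomposition`, verbatim.
[cite: Fulton1998, §19.1 Lemma 19.1.1] [cite: BlochSrinivas1983, Prop. 1] -/
theorem hodgeProjectorDivisorSupported_of_purity_of_crossDecomposition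
    (hK : ∀ ⦃n d e : ℕ⦄ ⦃X : SchemeOver ℂ⦄ (hX : IsSmoothProjective n X) (hde : d + e = n)
      (ρ : ResolutionFamily X d),
      algebraicClasses X e ≤
        Submodule.span ℂ (Set.range (cycleClass complexOrientationFamily hX hde ρ)))
    (hH : ∀ (n : ℕ) (X : SchemeOver ℂ) (hX : IsSmoothProjective (2 * n) X)
      (ρ : ResolutionFamily (X ⊗ X) (2 * n)), 1 ≤ n →
      ∀ (Z : ↥(cyclesOfDim (X ⊗ X).left (2 * n))) (u : ℂ), u ≠ 0 →
        (∀ c : complexBetti X (2 * n), IsRationalClass c → IsOfHodgeType (2 * n) X (2 * n) n n c →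
          corrAction complexOrientationFamily hX hX
            (rfl : 2 * n + 2 * (2 * n) = 2 * n + 2 * (2 * n))
            (cycleClass complexOrientationFamily (IsSmoothProjective.tensor_holds hX hX)
              (rfl : 2 * n + 2 * n = 2 * n + 2 * n) ρ Z) c = u • c) →
        (∀ b : complexBetti X (2 * n),
          (∀ a : complexBetti X (2 * n), IsRationalClass a → IsOfHodgeType (2 * n) X (2 * n) n n a →
            cupProduct (rfl : 2 * n + 2 * n = 2 * n + 2 * n) a b = 0) →
          corrAction complexOrientationFamily hX hX
            (rfl : 2 * n + 2 * (2 * n) = 2 * n + 2 * (2 * n))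
            (cycleClass complexOrientationFamily (IsSmoothProjective.tensor_holds hX hX)
              (rfl : 2 * n + 2 * n = 2 * n + 2 * n) ρ Z) b = 0) →
        ∃ D : Set X.left, IsClosed D ∧ D ≠ Set.univ ∧
          ∃ (Z' Z'' : ↥(cyclesOfDim (X ⊗ X).left (2 * n))) (m : ℕ), 0 < m ∧
            (∀ z, (Z' : AlgebraicCycle (X ⊗ X).left ℤ) z ≠ 0 → (fst X X).left.base z ∈ D) ∧
            (∀ z, (Z'' : AlgebraicCycle (X ⊗ X).left ℤ) z ≠ 0 → (snd X X).left.base z ∈ D) ∧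
            ∀ c : complexBetti X (2 * n),
              corrAction complexOrientationFamily hX hX
                  (rfl : 2 * n + 2 * (2 * n) = 2 * n + 2 * (2 * n))
                  (cycleClass complexOrientationFamily (IsSmoothProjective.tensor_holds hX hX)
                    (rfl : 2 * n + 2 * n = 2 * n + 2 * n) ρ (Z' + Z'')) c =
                (m : ℂ) • corrAction complexOrientationFamily hX hX
                  (rfl : 2 * n + 2 * (2 * n) = 2 * n + 2 * (2 * n))
                  (cycleClass complexOrientationFamily (IsSmoothProjective.tensor_holds hX hX)
                    (rfl : 2 * n + 2 * n = 2 * n + 2 * n) ρ Z) c) :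
    Summit.HodgeConjecture.HodgeConjecture.Theses.HodgeProjectorDivisorSupport.HodgeProjectorDivisorSupported := by
  intro n X hX ρ hn hπ
  obtain ⟨π, hπalg, hid, hzero⟩ := hπ
  have hspan : π ∈ Submodule.span ℂ (Set.range (cycleClass complexOrientationFamily
      (IsSmoothProjective.tensor_holds hX hX) (rfl : 2 * n + 2 * n = 2 * n + 2 * n) ρ)) :=
    hK (IsSmoothProjective.tensor_holds hX hX) (rfl : 2 * n + 2 * n = 2 * n + 2 * n) ρ hπalg
  obtain ⟨Z, u, hu, hZid, hZzero⟩ := stub_integralProjectorCycle n X hX ρ hn π hspan hid hzero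
  obtain ⟨D, hDcl, hDne, Z', Z'', m, hm, hZ'D, hZ''D, hact⟩ := hH n X hX ρ hn Z u hu hZid hZzero
  refine ⟨D, hDcl, hDne, Z', Z'', (m : ℂ) * u, mul_ne_zero (by exact_mod_cast hm.ne') hu, hZ'D, hZ''D,
    fun c hc hh ↦ ?_, fun b hb ↦ ?_⟩
  · rw [hact c, hZid c hc hh, smul_smul]
  · rw [hact b, hZzero b hb, smul_zero]

end Crux

end Summit.HodgeConjecture.HodgeConjecture.Theorems.HodgeProjectorDivisorSupported

end
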